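import Mathlib
import HarnessLib
import HarnessLib.Audit
import Summits.AtomisticToContinuum.Statement
import Literature.MathematicalPhysics.KineticTheory.InfiniteChainDynamics
import Summits.AtomisticToContinuum.FouriersLaw.Theorems.EmbeddedDrudeMourreNessUnique
import Summits.AtomisticToContinuum.FouriersLaw.Theorems.FourierGreenKuboFourierFiniteResponseOfUnique
import HarnessLib.Audit.Status.Attr

/-!
Route: KineticCorner

X_K (KINETIC CORNER; realises idea card
AtomisticToContinuum/FouriersLaw/kinetic-corner-deng-hani-post-kinetic-tail). REGIME route. By the
proved amplitude-scaling conjugacy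
(Literature.Barriers.AtomisticToContinuum.LowTemperatureWeakAnharmonicity: κ_{lam,β}(T) =
κ_{lamT,βT}(1)) the low-temperature corner T → 0⁺ of the conjunct at fixed (ω₂, lam, β) IS the
weakly anharmonic corner — the only corner of FouriersLaw with a small parameter. There the kinetic
time is t ≍ T⁻² and, for the infinite pinned chain, T²·κ_GK(T) = ∫₀^∞ C_T(t) dt with C_T =
InfiniteChainDynamics.currentCorrelation (Σ_x E_{μ_T}[j_0 · j_x∘φ_t]). Call a triple (T, μ, D) GOOD
if μ is a translation-invariant DLR Gibbs state of pinnedChain ω₂ lam β γ at T and D a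
shift-covariant μ-preserving infinite-volume dynamics with absolutely convergent, locally integrable
current correlations (the six-conjunct bundle written out in every item). It suffices to show:
 (PostKineticTail, crux rank 2) the Green–Kubo integrand has uniformly small mass beyond every large
kinetic multiple: ∀e>0 ∃M,T₀ ∀T<T₀ ∀good: C_T ∈ L¹(MT⁻², ∞) and ∫_{MT⁻²}^∞ |C_T| ≤ e;
 (KineticLimit, crux rank 3) kinetic theory computes the integral on every kinetic window: ∃K ∈
L¹(0,∞) with ∫₀^∞ K > 0 such that ∫_{δT⁻²}^{MT⁻²} C_T → ∫_δ^M K as T → 0⁺, uniformly over good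
triples, for all 0 < δ ≤ M (K(τ) = ⟨v, e^{−τL} v⟩ for the linearised 2↔2 phonon collision operator L
of the pinned band ω(k)² = ω₂ + 4 sin²(k/2) with quartic vertex lam + β·Π(e^{ik_j} − 1):
Aoki–Lukkarinen–Spohn 2006 §3 made a theorem for ALL kinetic multiples, Deng–Hani /
Bodineau–Gallagher–Saint-Raymond–Simonella technology transplanted to equilibrium time correlations
of the thermal lattice);
 (NoOddCollisionalInvariant, crux rank 4) the 2↔2 resonant manifold of the pinned band carries no
odd continuous collisional invariant (ALS06 §4: 'expected, no proof'; Spohn 2006: d ≥ 2 only) — the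
kinetic shadow of the Mazur barrier and the input for 0 < ∫₀^∞ K < ∞;
 with supports StationaryCorrelationBound (|C_T(t)| ≤ B·T²), GoodFamilyExists (InfiniteVolumeSetup
0743 strengthened by translation covariance and summable space-time current correlations) and the
pure real-analysis glue TargetGlue: PostKineticTail → KineticLimit → StationaryCorrelationBound →
GoodFamilyExists → Target (tiling (0,∞) = initial layer ∪ kinetic window ∪ far tail; dominated, not
Fatou).
TARGET KineticCornerGreenKubo: ∀ ω₂ lam β γ > 0 ∃ c > 0, T₀ > 0: (i) for T ∈ (0, T₀) some Gibbs
state and Gibbs-preserving dynamics satisfy HasGreenKubo — crux FourierGreenKubo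
(stmt-AtomisticToContinuum-0703) ON THE CORNER — and (ii) the Aoki–Lukkarinen–Spohn law: every good
triple with T < T₁(e) has HasGreenKubo and |T²κ_GK(T) − c| ≤ e (the pinnedChain analogue of the
conjectural fact AokiLukkarinenSpohn2006_kineticLowTemperature_prediction, κ ≅ c·T⁻² = C(lamT)⁻²).
ASSEMBLY to the conjunct: KineticCornerGreenKubo → KineticCornerComplement (Green–Kubo above T₀: the
large-anharmonicity half of the conjunct, NOT attacked by this route, trivially implied by 0703,
shared target for continuation lines) → NessUnique (0741) → FiniteResponseOfUnique (0717) →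
ThermodynamicLimit (0742) → FouriersLaw; glue verified rc0 in the planner sketch (25 lines, clause
(i) existence from the PROVED fact CuneoEckmannHairerReyBellet2018_pinnedChain_holds).
Lean (Target, one line, elaborates against
Literature.MathematicalPhysics.KineticTheory.InfiniteChainDynamics): ∀ ω₂ lam β γ, 0 < ω₂ → 0 < lam
→ 0 < β → 0 < γ → ∃ c T₀, 0 < c ∧ 0 < T₀ ∧ (∀ T, 0 < T → T < T₀ → ∃ μ, (pinnedChain ω₂ lam β
γ).IsChainGibbsMeasure T μ ∧ ∃ D : InfiniteChainDynamics (pinnedChain ω₂ lam β γ),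
D.PreservesMeasure μ ∧ D.HasGreenKubo μ T) ∧ ∀ e > 0, ∃ T₁ > 0, ∀ T μ D, 0 < T → T < T₁ → Good T μ D
→ D.HasGreenKubo μ T ∧ |T ^ 2 * D.greenKuboConductivity μ T − c| ≤ e.

Rationale: WHY THIS LINE. The conjunct asks 0 < κ(T) < ∞ at every T; by the PROVED amplitude-scaling conjugacy
(LowTemperatureWeakAnharmonicity) T → 0⁺ at fixed (lam, β) is the weak-anharmonicity corner (lamT,
βT) → 0 at unit temperature — the only corner of the parameter square with a small parameter,
catalogued as an obstruction (ballistic harmonic end point; Gaussian closure void,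
BricmontKupiainen2007 §3; kinetic law κ ≅ C(lamT)⁻² conjectural: AokiLukkarinenSpohn2006 §3 'even
(3.23) is tentative', Lukkarinen2016 §2.1, LefevereSchenkel2006). The route turns the obstruction
into the one place where Green–Kubo is COMPUTABLE: kinetic time t ≍ T⁻², T²κ_GK(T) = ∫₀^∞ C_T, and
the integral is TILED into an initial layer (0, δT⁻²] (static bound), kinetic windows [δT⁻², MT⁻²]
(wave-kinetic theory made a theorem for ALL kinetic multiples: transplant of the Deng–Hani
diagram/molecule expansions DengHani2023, DengHani2026, arXiv:2311.10082 and of the equilibrium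
L²-duality/pruning strategy of Bodineau–Gallagher–Saint-Raymond–Simonella doi:10.1002/cpa.22120,
doi:10.1007/s00023-022-01257-y, which controls equilibrium covariances of hard spheres by the
linearised Boltzmann equation for arbitrarily long kinetic and even diffusive times; lattice
precedent at short kinetic time LukkarinenSpohn2010 Thm 2.4; stochastic precedent Basile–Olla–Spohn
doi:10.1007/s00205-008-0205-6) and a far tail [MT⁻², ∞) whose T-uniform smallness (PostKineticTail)
is the single non-perturbative input. Areas imported: dispersive-PDE wave turbulence
(counting/molecule estimates), kinetic theory of gases at equilibrium (duality–pruning),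
resonance-variety real analysis (collisional invariants; Spohn2006 proves d ≥ 2 only). No physical
analogy beyond the Peierls dictionary phonon ↦ mode energy |a(k)|², an identity here (ALS06
(3.5)–(3.9)).
RANKED CRUXES. (2) PostKineticTail: ∀e ∃M,T₀ ∀T<T₀ ∀good (μ,D): ∫_{MT⁻²}^∞|C_T| ≤ e — decorrelation
of the energy current beyond every kinetic multiple, uniformly in small T; hardest, most informative
(it is 0703 restricted to the corner with a small parameter in hand; candidate mechanisms: renewal
of the kinetic derivation on consecutive windows via propagation of quasi-Gibbsianness = Deng–Hani
'propagation of chaos / higher-order statistics'; BGSS pruning beyond kinetic times; hydrodynamic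
t^{-3/2} tail with T-uniform amplitude). (3) KineticLimit: window form of the kinetic limit with ∃K
∈ L¹, ∫K > 0 (K = ⟨v,e^{−τL}v⟩, L the linearised 2↔2 collision operator of the pinned band with
vertex lam + βΠ(e^{ik_j}−1); definition pinnedChainCollisionOperator requested; glued split
identification/positivity planned once it lands). (4) NoOddCollisionalInvariant: the open d = 1
classification question of ALS06 §4 in the parity sector, typed as real analysis (checked this
session: the 3↔1 processes are non-resonant for EVERY ω₂ > 0 once momentum conservation is imposed —
min over 𝕋³ of ω₁+ω₂+ω₃ − ω(k₁+k₂+k₃) > 0 numerically for ω₂ ∈ [0.01, 3] — so the kinetic operator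
is the pair operator with even invariants 1, ω at all ω₂, as ALS state); cheapest kill.
TARGET / GLUE / ASSEMBLY. Target KineticCornerGreenKubo = 0703 on the corner + the ALS law;
TargetGlue (support, provable NOW, pure real analysis: dominated tiling) certifies cruxes ⇒ Target;
Assembly = Target → KineticCornerComplement → NessUnique (0741) → FiniteResponseOfUnique (0717) →
ThermodynamicLimit (0742) → FouriersLaw, glue verified rc0 in the planner sketch (SketchCheck.lean,
25 lines, clause (i) existence from the proved fact
CuneoEckmannHairerReyBellet2018_pinnedChain_holds). SCOPE stated plainly: a REGIME route; the
conjunct additionally needs KineticCornerComplement (Green–Kubo above T₀ = the large-anharmonicity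
half; no mechanism here; implied by 0703; a typed shared target for continuation lines such as card
complete-analyticity-vitali-propagation) and the FourierGreenKubo frame (0741, 0717, 0742, re-asked
verbatim so they dedupe).
KILL CRITERIA. (a) an odd collisional invariant at some ω₂ refutes crux 4 and the positivity clause
of crux 3 there (isolated exception set or death); (b) equilibrium MD at lamT = βT ∈ {0.02, 0.05,
0.1}: no window collapse of ∫_{δT⁻²}^{MT⁻²}C_T, or a far-tail mass independent of M, refutes
KineticLimit resp. PostKineticTail — either closes the route; (c) a proof that C_T ∉ L¹ at some
small T refutes the Target and 0703 itself (then file ¬FourierGreenKubo).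
NOT DECOMPOSED YET. The engine inside KineticLimit (counting estimates for the degenerate d = 1
lattice dispersion with ω′ = 0 at k = 0, π; cumulant/cluster expansion of the quartic Gibbs state
uniformly in volume; all-M uniformity; no U(1) symmetry); the mechanism of PostKineticTail;
coercivity of L on the odd sector (L = ν − A with inf ν > 0 expected for the gapped band, versus the
|k|^{5/3} zero of the FPU band, LukkarinenSpohn2008 Lemma 4.1); KineticCornerComplement. KNOWN
FORMAL GAP (for refuters): cruxes quantify over ALL good triples; that every good dynamics gives the
same C_T is expected (uniqueness of tempered solutions, LanfordLebowitzLieb1977 Thm 4;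
ButtaEtAl2007) but not encoded — if an exotic good D is exhibited, restate 'good' with a
severed-flow-limit clause (same decl names). Statements are in ORIGINAL variables (T → 0⁺ at fixed
couplings) so that the Target plugs into 0742 without an infinite-volume scaling lemma.
NOVELTY / BARRIERS: in the route's Novelty and Barriers fields (nearest prior art BGSS +
LukkarinenSpohn2010 + Deng–Hani; new combination aimed at a Green–Kubo THEOREM with the tail bound
isolated; LowTemperatureWeakAnharmonicity met head-on and evaded only in the admissible sense,
LukkarinenSpohn2008_lemma41 / FPUBetaKineticAnomalyNarrow excluded by pinning, Mazur via crux 4 +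
PostKineticTail, MacroErgodicityBarrier partially applies to PostKineticTail, HasBoundedResponse
deferred to 0742).

Novelty: SEARCHES RUN (this session; search-before-claim): crossref 'long-time correlations hard-sphere gas
equilibrium linearized Boltzmann Bodineau Gallagher Saint-Raymond Simonella' →
doi:10.1002/cpa.22120, doi:10.1214/23-aop1656, doi:10.4007/annals.2023.198.3.3,
doi:10.1007/s40818-016-0018-0; crossref 'Dynamics of dilute gases at equilibrium … fluctuating
hydrodynamics' → doi:10.1007/s00023-022-01257-y; crossref 'energy transport stochastically perturbed
lattice dynamics kinetic limit phonon Boltzmann' → doi:10.1007/s00205-008-0205-6,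
doi:10.1007/s10955-005-8088-5; crossref 'Long time justification of wave turbulence theory Deng
Hani' → doi:10.1007/s00205-026-02181-9 (Grande–Hani damped-driven); crossref 'large-period limit
equations of discrete turbulence Dymov Kuksin Maiocchi' → doi:10.1007/s00023-023-01366-2,
doi:10.1007/s00220-021-03955-w; crossref 'propagation of a perturbation in an anharmonic system' →
doi:10.1007/s10955-007-9278-0; `lit frontier AtomisticToContinuum --since 2020` (30 newest
descendants: no kinetic-limit theorem for the thermal φ⁴/FPU lattice at or beyond kinetic time;
arXiv:2603.23298 molecule-reduction algorithm and doi:10.1002/cpa.70035 long-time linearised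
Boltzmann noted); `lit read arXiv:cond-mat/0602082` pp.4–6 (ALS06 §3–4: collision operator (3.20),
non-perturbative branch h(k₁;k₃) (4.5)–(4.7), 'We expect that there are no further solutions, but no
proof is available', 'even the claim (3.23) is tentative'); `lit read arXiv:math-ph/0605069`
(Spohn200  [refs: 10.1002/cpa.22120, 10.1214/23-aop1656, 10.4007/annals.2023.198.3.3, 10.1007/s40818-016-0018-0, 10.1007/s00023-022-01257-y, 10.1007/s00205-008-0205-6, 10.1007/s10955-005-8088-5, 10.1007/s00205-026-02181-9, 10.1007/s00023-023-01366-2, 10.1007/s00220-021-03955-w, 10.1007/s10955-007-9278-0, 10.1002/cpa.70035, 10.1007/s00222-010-0276-5, 2603.23298, cond-mat/0602082, math-ph/0605069, 2311.10082, doi:10.]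

Barriers (technique_class: kinetic-limit-long-time feynman-diagrams post-kinetic-tail): technique_class: kinetic-limit-long-time feynman-diagrams post-kinetic-tail
- Literature.Barriers.AtomisticToContinuum.LowTemperatureWeakAnharmonicity: APPLIES head-on — the
route expands around the harmonic chain; evaded only in the admissible sense: nothing T-uniform is
claimed (the Target PROVES the entry's predicted divergence, T²κ_GK(T) → c > 0, i.e. κ ≅ c·T⁻² =
C(lamT)⁻²), the expansion is a resummation on kinetic windows t ≍ T⁻² (the entry's own recorded
evasion 'kinetic theory of phonons'), not a finite-order or Gaussian closure (BricmontKupiainen2007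
§3: G₄ᶜ = 0 reproduces the harmonic chain), and ALL non-perturbative content is quarantined in crux
PostKineticTail; the entry's audit note on the second scale τ₂ ∼ (λT)^{-2p} (phonon-number
quasi-conservation, HuveneersLukkarinen2020) is met by parity at the kinetic level — number and
energy are EVEN invariants, the current weight is ODD (crux NoOddCollisionalInvariant), so number
relaxation does not enter K(τ) = ⟨v, e^{−τL}v⟩ — and is PostKineticTail's explicitly stated risk
beyond kinetic times.
- Literature.Barriers.AtomisticToContinuum.LukkarinenSpohn2008_lemma41 and
Literature.Barriers.AtomisticToContinuum.FPUBetaKineticAnomalyNarrow: not met — the conjunct's band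
ω(k)² = ω₂ + 4 sin²(k/2) is gapped (δ = 1/(ω₂+2) < 1/2 strictly), ω(0) > 0, the collision frequency
has no |k|^{5/3} zero, and the argument does NOT survive setting ω₂ = lam = 0 (pinning enters
through the gap and the resonance branch h(k₁;k₃)); conjunct

Novelty grade: new-combination — refuter route-review grade: NEW-COMBINATION (agrees with the card audit refuter-novelty-audit-AtomisticToContinuum-FouriersLaw-2-0). Joined knowns: long-time equilibrium-correlation kinetic limits (BGSS duality/pruning for hard spheres; Deng–Hani wave-kinetic derivations; Lukkarinen–Spohn 2010 latti (refuter refuter-rreview-route-KontsevichZagierPe-b1cffd87-0, 2026-08-15T13:39:11Z; prior: doi:10.1002/cpa.22120, doi:10.1007/s00023-022-01257-y (BGSS), doi:10.1007/s00222-010-0276-5 (LukkarinenSpohn2010), DengHani2023/2026 + arXiv:2311.10082, doi:10.1007/s00205-008-0205-6 (Basile–Olla–Spohn), AokiLukkarinenSpohn2006 (cond-mat/0602082 §3–4), Spohn2006, LukkarinenSpohn2008)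

sub-problem: FouriersLaw · status: done · opened planner-plancard-AtomisticToContinuum-Fourier-bc92fae1-0 2026-08-15T11:17:48Z · rev 1 · ledger route-AtomisticToContinuum-KineticCorner
GENERATED by the gate from the ledger (D-0016/17). Provers cite these decls: `theorem foo : Summit.AtomisticToContinuum.FouriersLaw.Theses.KineticCorner.<Decl> := …` in Summits/AtomisticToContinuum/FouriersLaw/Theorems/<Name>.lean.
-/

namespace Summit.AtomisticToContinuum.FouriersLaw.Theses.KineticCorner

open scoped BigOperators Topology Manifold Classical MeasureTheory ProbabilityTheory Matrix InnerProductSpace ComplexConjugate ContinuousMap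
open Filter Set Function TopologicalSpace MeasureTheory

attribute [summit_statement] _root_.FouriersLaw

/-- item stmt-AtomisticToContinuum-3429 · target · rank 0 · open · by planner
why it might fail: Inherits PostKineticTail and KineticLimit (see TargetGlue); stated over ALL good triples (uniqueness of the physical dynamics in that class expected, LanfordLebowitzLieb1977 Thm 4, not encoded).
sources: AokiLukkarinenSpohn2006, Lukkarinen2016, BonettoLebowitzReyBellet2000
[target] KINETIC-CORNER GREEN–KUBO WITH THE AOKI–LUKKARINEN–SPOHN LAW (the regime deliverable). For
pinnedChain ω₂ lam β γ (all > 0) there are c > 0 and T₀ > 0 with: (i) for every T ∈ (0, T₀) some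
Gibbs state μ and μ-preserving infinite-volume dynamics D satisfy HasGreenKubo μ T — i.e. the
conclusion of crux FourierGreenKubo (stmt-AtomisticToContinuum-0703) ON THE CORNER; (ii) for every e
> 0 there is T₁ > 0 such that EVERY GOOD triple (T, μ, D): μ a DLR Gibbs state of pinnedChain ω₂ lam
β γ at T (IsChainGibbsMeasure), D an InfiniteChainDynamics preserving μ, absolutely convergent
current correlations at every t (HasAbsConvergentCorrelation), t ↦ C_T(t) := D.currentCorrelation μ
t locally integrable on [0,S], μ invariant under the lattice shift σ ↦ σ(·+1), and the flow
shift-covariant. with T < T₁ has HasGreenKubo and |T²·κ_GK(T) − c| ≤ e (T²κ_GK = ∫₀^∞ C_T; kinetic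
prediction c = ∫₀^∞ K = ⟨v, L⁻¹ v⟩-type constant; in the conjugate variables κ_{lam,β}(T) =
κ_{lamT,βT}(1) ≅ c·T⁻²: the pinnedChain analogue of the conjectural fact
Literature.Barriers.AtomisticToContinuum.AokiLukkarinenSpohn2006_kineticLowTemperature_prediction,
which is stated for phi4Chain). Why it might fail: inheri -/
@[route_item "route-AtomisticToContinuum-KineticCorner", crux]
def KineticCornerGreenKubo : Prop :=
  ∀ ω₂ lam β γ : ℝ, 0 < ω₂ → 0 < lam → 0 < β → 0 < γ → ∃ c T₀ : ℝ, 0 < c ∧ 0 < T₀ ∧ (∀ T : ℝ, 0 < T → T < T₀ → ∃ μ : MeasureTheory.Measure Literature.MathematicalPhysics.KineticTheory.HeatConduction.ChainConfig, (Literature.MathematicalPhysics.KineticTheory.HeatConduction.pinnedChain ω₂ lam β γ).IsChainGibbsMeasure T μ ∧ ∃ D : Literature.MathematicalPhysics.KineticTheory.HeatConduction.InfiniteChainDynamics (Literature.MathematicalPhysics.KineticTheory.HeatConduction.pinnedChain ω₂ lam β γ), D.PreservesMeasure μ ∧ D.HasGreenKubo μ T) ∧ ∀ e : ℝ, 0 <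 e → ∃ T₁ : ℝ, 0 < T₁ ∧ ∀ (T : ℝ) (μ : MeasureTheory.Measure Literature.MathematicalPhysics.KineticTheory.HeatConduction.ChainConfig) (D : Literature.MathematicalPhysics.KineticTheory.HeatConduction.InfiniteChainDynamics (Literature.MathematicalPhysics.KineticTheory.HeatConduction.pinnedChain ω₂ lam β γ)), 0 < T → T < T₁ → ((Literature.MathematicalPhysics.KineticTheory.HeatConduction.pinnedChain ω₂ lam β γ).IsChainGibbsMeasure T μ ∧ D.PreservesMeasure μ ∧ (∀ t : ℝ, D.HasAbsConvergentCorrelation μ t) ∧ (∀ S : ℝ, MeasureTheory.IntegrableOn (D.currentCorrelation μ) (Set.Icc 0 S)) ∧ MeasureTheory.MeasurePreserving (fun σ : Literature.MathematicalPhysics.KineticTheory.HeatConduction.ChainConfig => fun i : ℤ => σ (i + 1)) μ μ ∧ (∀ (t : ℝ) (σ : Literature.MathematicalPhysics.KineticTheory.HeatConduction.ChainConfig), D.flow t (fun i : ℤ => σ (i + 1)) = fun i : ℤ => D.flow t σ (i + 1))) → D.HasGreenKubo μ T ∧ |T ^ 2 * D.greenKuboConductivity μ T - c| ≤ e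

/-- item stmt-AtomisticToContinuum-3430 · crux · rank 2 · open · by planner
why it might fail: Non-perturbative: at FIXED small T the chain must decorrelate beyond ALL kinetic multiples; a hidden odd extensive charge (Mazur/Drude plateau), slow hydrodynamic or phonon-number modes (τ₂∼(λT)^-2p, HL2020) feeding the odd sector, or breathers could leave far-tail mass ≥ e uniformly in T.
sources: LukkarinenSpohn2008, Lukkarinen2016, doi:10.1002/cpa.22120, doi:10.1007/s00023-022-01257-y, HuveneersLukkarinen2020, AokiLukkarinenSpohn2006
[crux] POST-KINETIC TAIL BOUND (Step 2 of the card; the single non-perturbative input). For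
pinnedChain ω₂ lam β γ (all > 0) and every e > 0 there are M > 0, T₀ > 0 such that for every GOOD
triple (T, μ, D): μ a DLR Gibbs state of pinnedChain ω₂ lam β γ at T (IsChainGibbsMeasure), D an
InfiniteChainDynamics preserving μ, absolutely convergent current correlations at every t
(HasAbsConvergentCorrelation), t ↦ C_T(t) := D.currentCorrelation μ t locally integrable on [0,S], μ
invariant under the lattice shift σ ↦ σ(·+1), and the flow shift-covariant. with 0 < T < T₀: C_T is
integrable on (M·T⁻², ∞) and ∫_{M T⁻²}^∞ |C_T(t)| dt ≤ e. Units: the kinetic time is t ≍ (lamT)⁻² ≍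
T⁻² in ORIGINAL time (amplitude scaling does not rescale time) and T²κ_GK(T) = ∫₀^∞ C_T, so this
says: the Green–Kubo integral has T-uniformly small mass beyond every large kinetic multiple — decay
of current correlations beyond ALL kinetic times at FIXED small T, which no kinetic-limit theorem
provides (LukkarinenSpohn2010; Deng–Hani; BGSS doi:10.1002/cpa.22120, doi:10.1007/s00023-022-01257-y
reach arbitrarily long kinetic and diffusive times but never t = ∞ at fixed ε). Candidate
mechanisms: renewal of the kinetic -/
@[route_item "route-AtomisticToContinuum-KineticCorner", crux]
def PostKineticTail : Prop :=
  ∀ ω₂ lam β γ : ℝ, 0 < ω₂ → 0 < lam → 0 < β → 0 < γ → ∀ e : ℝ, 0 < e → ∃ M T₀ : ℝ, 0 < M ∧ 0 < T₀ ∧ ∀ (T : ℝ) (μ : MeasureTheory.Measure Literature.MathematicalPhysics.KineticTheory.HeatConduction.ChainConfig) (D : Literature.MathematicalPhysics.KineticTheory.HeatConduction.InfiniteChainDynamics (Literature.MathematicalPhysics.KineticTheory.HeatConduction.pinnedChain ω₂ lam β γ)), 0 < T → T < T₀ → ((Literature.MathematicalPhysics.KineticTheory.HeatConduction.pinnedChain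 ω₂ lam β γ).IsChainGibbsMeasure T μ ∧ D.PreservesMeasure μ ∧ (∀ t : ℝ, D.HasAbsConvergentCorrelation μ t) ∧ (∀ S : ℝ, MeasureTheory.IntegrableOn (D.currentCorrelation μ) (Set.Icc 0 S)) ∧ MeasureTheory.MeasurePreserving (fun σ : Literature.MathematicalPhysics.KineticTheory.HeatConduction.ChainConfig => fun i : ℤ => σ (i + 1)) μ μ ∧ (∀ (t : ℝ) (σ : Literature.MathematicalPhysics.KineticTheory.HeatConduction.ChainConfig), D.flow t (fun i : ℤ => σ (i + 1)) = fun i : ℤ => D.flow t σ (i + 1))) → MeasureTheory.IntegrableOn (D.currentCorrelation μ) (Set.Ioi (M / T ^ 2)) ∧ ∫ t in Set.Ioi (M / T ^ 2), |D.currentCorrelation μ t| ≤ e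

/-- item stmt-AtomisticToContinuum-3431 · crux · rank 3 · open · by planner
why it might fail: Deng–Hani control NLS on tori up to δ·T_kin (all δ) with Gaussian random data; here: quartic Gibbs data (cumulants at every order, uniform in volume), d=1 band with degenerate points k=0,π (worse counting), no U(1), all multiples M; ALS06 App.A: 'rough estimates … not sufficient'.
sources: AokiLukkarinenSpohn2006, LukkarinenSpohn2010, DengHani2023, DengHani2026, arXiv:2311.10082, doi:10.1002/cpa.22120
[crux] WAVE-KINETIC LIMIT OF THE EQUILIBRIUM CURRENT CORRELATION ON EVERY KINETIC WINDOW (Step 1 of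
the card, window form + positivity of the kinetic constant). For pinnedChain ω₂ lam β γ (all > 0)
there is K : ℝ → ℝ, integrable on (0,∞) with ∫₀^∞ K > 0, such that for all 0 < δ ≤ M and e > 0 there
is T₀ > 0 with |∫_{δT⁻²}^{MT⁻²} C_T(t) dt − ∫_δ^M K(τ) dτ| ≤ e for every GOOD triple (T, μ, D): μ a
DLR Gibbs state of pinnedChain ω₂ lam β γ at T (IsChainGibbsMeasure), D an InfiniteChainDynamics
preserving μ, absolutely convergent current correlations at every t (HasAbsConvergentCorrelation), t
↦ C_T(t) := D.currentCorrelation μ t locally integrable on [0,S], μ invariant under the lattice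
shift σ ↦ σ(·+1), and the flow shift-covariant. with 0 < T < T₀. Identification (informal, the
content): K(τ) = lim_{T→0} T⁻²C_T(τT⁻²) is the ALS quadratic form ⟨ṽ, e^{−τ L̃} ṽ⟩ (ALS06 (3.22)
transported from phi4Chain to pinnedChain), L the linearised number-conserving 2↔2 phonon Boltzmann
collision operator (ALS06 (3.20), (4.1), (4.11)) of the PINNED band ω(k)² = ω₂ + 4 sin²(k/2) [=
ω₀²(1 − 2δ cos k), ω₀² = ω₂ + 2, δ = 1/(ω₂+2) < 1/2] with the on-site vertex λ replaced by the
combined quartic vertex -/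
@[route_item "route-AtomisticToContinuum-KineticCorner", crux]
def KineticLimit : Prop :=
  ∀ ω₂ lam β γ : ℝ, 0 < ω₂ → 0 < lam → 0 < β → 0 < γ → ∃ K : ℝ → ℝ, MeasureTheory.IntegrableOn K (Set.Ioi 0) ∧ 0 < ∫ τ in Set.Ioi 0, K τ ∧ ∀ δ M e : ℝ, 0 < δ → δ ≤ M → 0 < e → ∃ T₀ : ℝ, 0 < T₀ ∧ ∀ (T : ℝ) (μ : MeasureTheory.Measure Literature.MathematicalPhysics.KineticTheory.HeatConduction.ChainConfig) (D : Literature.MathematicalPhysics.KineticTheory.HeatConduction.InfiniteChainDynamics (Literature.MathematicalPhysics.KineticTheory.HeatConduction.pinnedChain ω₂ lam β γ)), 0 < T → T < T₀ → ((Literature.MathematicalPhysics.KineticTheory.HeatConduction.pinnedChain ω₂ lam β γ).IsChainGibbsMeasure T μ ∧ D.PreservesMeasure μ ∧ (∀ t : ℝ, D.HasAbsConvergentCorrelation μ t) ∧ (∀ S : ℝ, MeasureTheory.IntegrableOn (D.currentCorrelation μ) (Set.Icc 0 S)) ∧ MeasureTheory.MeasurePreserving (fun σ : Literature.MathematicalPhysics.KineticTheory.HeatConduction.ChainConfig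 => fun i : ℤ => σ (i + 1)) μ μ ∧ (∀ (t : ℝ) (σ : Literature.MathematicalPhysics.KineticTheory.HeatConduction.ChainConfig), D.flow t (fun i : ℤ => σ (i + 1)) = fun i : ℤ => D.flow t σ (i + 1))) → |(∫ t in (δ / T ^ 2)..(M / T ^ 2), D.currentCorrelation μ t) - ∫ τ in δ..M, K τ| ≤ e

/-- item stmt-AtomisticToContinuum-3432 · crux · rank 4 · closed · proved by Summit.AtomisticToContinuum.FouriersLaw.Theorems.KineticCorner.noOddCollisionalInvariant_kineticSlabContacts @ 375ff106628f (prover) · by planner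
why it might fail: ALS06 §4: 'we expect no further solutions, but no proof is available'; proved only for d≥2 (Spohn2006) and the FPU band (LS2008 Thm 2.2). As ω₂→∞ the branch degenerates (h→π−k₁) and infinitely many ODD invariants appear (sin 2k); one may survive at special ω₂.
sources: AokiLukkarinenSpohn2006, Spohn2006, LukkarinenSpohn2008, doi:10.1016/0167-2789(80)90011-1
[crux] NO ODD COLLISIONAL INVARIANT ON THE PINNED BAND (d = 1; card crux CollisionKernelPositivity,
parity half, typed as real analysis). For ω(k) = √(ω₂ + 2(1 − cos k)), ω₂ > 0: every continuous
2π-periodic ODD ψ with ψ(k₁) + ψ(k₂) = ψ(k₃) + ψ(k₁+k₂−k₃) whenever ω(k₁) + ω(k₂) = ω(k₃) +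
ω(k₁+k₂−k₃) (the 2↔2 energy–momentum resonant set: label exchanges ∪ the non-perturbative branch k₂
= h(k₁;k₃), ALS06 (4.2)–(4.7)) vanishes identically. With the even invariants 1, ω this is the
parity sector of 'ker L = span{1, ω}' — ALS06 §4 (4.9)–(4.10): 'We expect that there are no further
solutions, but no proof is available'; PROVED only for d ≥ 2 (Spohn2006, Proposition: the Hessian
argument needs d ≥ 2) and for the acoustic FPU band (LukkarinenSpohn2008 Thm 2.2). Role in the
route: the energy-current weight v ∝ ω′ω-type is odd, so v ⊥ ker L ⟺ no odd invariant — the input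
that makes ∫₀^∞ K = ⟨v, L⁻¹v⟩ > 0 and finite modulo coercivity (KineticLimit's positivity clause),
and the kinetic shadow of the Mazur barrier (an odd invariant = a kinetic-level Drude weight ⇒ K(τ)
↛ 0 ⇒ (lamT)²κ → ∞ at that ω₂; Zakharov–Schulman: extra invariant ⇔ degenerative dispersion law).
Degeneration to watch: as ω₂ -/
@[route_item "route-AtomisticToContinuum-KineticCorner"]
def NoOddCollisionalInvariant : Prop :=
  ∀ ω₂ : ℝ, 0 < ω₂ → ∀ ψ : ℝ → ℝ, Continuous ψ → Function.Periodic ψ (2 * Real.pi) → (∀ k : ℝ, ψ (-k) = -ψ k) → (∀ k₁ k₂ k₃ : ℝ, Real.sqrt (ω₂ + 2 * (1 - Real.cos k₁)) + Real.sqrt (ω₂ + 2 * (1 - Real.cos k₂)) = Real.sqrt (ω₂ + 2 * (1 - Real.cos k₃)) + Real.sqrt (ω₂ + 2 * (1 - Real.cos (k₁ + k₂ - k₃))) → ψ k₁ + ψ k₂ = ψ k₃ + ψ (k₁ + k₂ - k₃)) → ∀ k : ℝ, ψ k = 0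

/-- item stmt-AtomisticToContinuum-0717 · support · rank 9 · closed · proved by Summit.AtomisticToContinuum.FouriersLaw.Theorems.FourierGreenKubo.finiteResponseOfUnique_holds (prover) · by planner
CONDITIONAL FORM OF 0705 (supersedes it as the prover target; refuters pool-5/g3-0: 0705 stand-alone
quantifies over EVERY steady-state family and is false-prone if weak steady states were non-unique):
assuming UNIQUENESS of weak steady states (IsSteadyState class) for pinnedChain at all N, T_L, T_R >
0, the finite-N linear-response limit D_N(T) = lim_{δ→0, δ≠0} totalCurrent(μ_{N,T+δ/2,T−δ/2})/δ
exists for every T > 0 and N. Content: differentiability at equilibrium of NESS expectations of the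
polynomial currents in the bath temperatures (ReyBellet2003 arXiv:math-ph/0303021 Rem 4.4 (51)–(56)
finite-volume Green–Kubo; HairerMajda2009 arXiv:0909.4313 Thm 2.3 framework — their SDE Thm 4.4
Assumption 5 fails here, so verify Assumptions 1–3 via CEHR2018 (2.5)/Carmona2007 Thm 1.1(iv)
weighted spectral gap). N = 0, 1: totalCurrent ≡ 0, D = 0. Together with 0706 gives 0705. -/
@[route_item "route-AtomisticToContinuum-KineticCorner"]
def FiniteResponseOfUnique : Prop :=
  ∀ ω₂ lam β γ : ℝ, 0 < ω₂ → 0 < lam → 0 < β → 0 < γ → (∀ (N : ℕ) (T_L T_R : ℝ), 0 < T_L → 0 < T_R → ∀ μ ν : MeasureTheory.Measure (Literature.MathematicalPhysics.KineticTheory.HeatConduction.PhaseSpace N), (Literature.MathematicalPhysics.KineticTheory.HeatConduction.pinnedChain ω₂ lam β γ).IsSteadyState N T_L T_R μ → (Literature.MathematicalPhysics.KineticTheory.HeatConduction.pinnedChain ω₂ lam β γ).IsSteadyState N T_L T_R ν → μ = ν) → ∀ μ : (N : ℕ) → ℝ → ℝ → MeasureTheory.Measure (Literature.MathematicalPhysics.KineticTheory.HeatConduction.PhaseSpace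 N), (∀ (N : ℕ) (T_L T_R : ℝ), 0 < T_L → 0 < T_R → (Literature.MathematicalPhysics.KineticTheory.HeatConduction.pinnedChain ω₂ lam β γ).IsSteadyState N T_L T_R (μ N T_L T_R)) → ∀ T : ℝ, 0 < T → ∀ N : ℕ, ∃ D : ℝ, Filter.Tendsto (fun δ : ℝ => (Literature.MathematicalPhysics.KineticTheory.HeatConduction.pinnedChain ω₂ lam β γ).totalCurrent (μ N (T + δ / 2) (T - δ / 2)) / δ) (nhdsWithin 0 {(0 : ℝ)}ᶜ) (nhds D)

/-- `FiniteResponseOfUnique` holds: proved by `Summit.AtomisticToContinuum.FouriersLaw.Theorems.FourierGreenKubo.finiteResponseOfUnique_holds`. -/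
theorem FiniteResponseOfUnique_holds : FiniteResponseOfUnique := _root_.Summit.AtomisticToContinuum.FouriersLaw.Theorems.FourierGreenKubo.finiteResponseOfUnique_holds

/-- item stmt-AtomisticToContinuum-0741 · support · rank 9 · closed · proved by Summit.AtomisticToContinuum.FouriersLaw.Theorems.nessUnique_proof (prover) · by planner
[crux] UNIQUENESS OF THE WEAK STEADY STATE (the half of stmt-0706 not covered by the landed fact
Literature.MathematicalPhysics.KineticTheory.HeatConduction.CuneoEckmannHairerReyBellet2018_pinnedChain,
p3544): for pinnedChain ω₂ lam β γ (all > 0), every N and T_L, T_R > 0, any two measures in the weak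
Fokker–Planck class IsSteadyState (probability, ∫ L f dμ = 0 for f ∈ C_c^∞, bond currents
integrable) coincide. Print: uniqueness of the INVARIANT MEASURE of the Langevin semigroup
(CuneoEckmannHairerReyBellet2018 Thm 2.13(1): C1, C2, CA; Carmona2007 Thm 1.1(iii)); the item
additionally needs 'weak stationary probability solution of L*μ = 0 ⇒ P_t-invariant' for this
hypoelliptic L with cubic drift (Echeverría 1982 well-posed martingale problem on C_c^∞ +
non-explosion via e^{θH}; Bogachev–Krylov–Röckner–Shaposhnikov 2015 Ch. 5 is non-degenerate only) —
the FP-identification lemma is the formal crux. N = 0: PhaseSpace 0 is a point (unique probability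
measure); N = 1: both baths on site 0, OU at temperature (T_L+T_R)/2. This is exactly the hypothesis
of FiniteResponse and ThermodynamicLimit and, with the fact, gives clause (i) of FouriersLawFor. -/
@[route_item "route-AtomisticToContinuum-KineticCorner"]
def NessUnique : Prop :=
  ∀ ω₂ lam β γ : ℝ, 0 < ω₂ → 0 < lam → 0 < β → 0 < γ → ∀ (N : ℕ) (T_L T_R : ℝ), 0 < T_L → 0 < T_R → ∀ μ ν : MeasureTheory.Measure (Literature.MathematicalPhysics.KineticTheory.HeatConduction.PhaseSpace N), (Literature.MathematicalPhysics.KineticTheory.HeatConduction.pinnedChain ω₂ lam β γ).IsSteadyState N T_L T_R μ → (Literature.MathematicalPhysics.KineticTheory.HeatConduction.pinnedChain ω₂ lam β γ).IsSteadyState N T_L T_R ν → μ = ν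

/-- `NessUnique` holds: proved by `Summit.AtomisticToContinuum.FouriersLaw.Theorems.nessUnique_proof`. -/
theorem NessUnique_holds : NessUnique := _root_.Summit.AtomisticToContinuum.FouriersLaw.Theorems.nessUnique_proof

/-- item stmt-AtomisticToContinuum-0742 · support · rank 9 · open · by planner
[crux] THERMODYNAMIC LIMIT OF THE RESPONSE COEFFICIENT, WITNESS FORM (supersedes
stmt-AtomisticToContinuum-0704; refuters g12-0/1/2/3/5: the ∀(μ_T,D) form hid the claim that κ_GK is
the same for every DLR state and every dynamics). Under weak-NESS uniqueness and T > 0, IF some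
Gibbs state with a μ_T-preserving Green–Kubo dynamics exists (hypothesis = GreenKubo at T), THEN
there is such a pair (μ_T, D), fixed before the steady-state family is chosen, such that for every
steady-state family μ and every sequence Dn of finite-volume response coefficients (Dn N =
lim_{δ→0,δ≠0} totalCurrent(μ N (T+δ/2) (T−δ/2))/δ, existence = FiniteResponse, uniqueness of limits
makes Dn canonical) one has Dn → greenKuboConductivity D μ_T T. Content: finite-volume Kubo formula
(ReyBellet2003 Rem 4.4 (56)) + N-uniform decay of equilibrium current correlations of the Langevin
chain + o(1) boundary layers at the baths; open (BonettoLebowitzReyBellet2000 §7 after (37)). N = 0,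
1: Dn = 0, irrelevant to atTop. -/
@[route_item "route-AtomisticToContinuum-KineticCorner"]
def ThermodynamicLimit : Prop :=
  ∀ ω₂ lam β γ : ℝ, 0 < ω₂ → 0 < lam → 0 < β → 0 < γ → (∀ (N : ℕ) (T_L T_R : ℝ), 0 < T_L → 0 < T_R → ∀ μ ν : MeasureTheory.Measure (Literature.MathematicalPhysics.KineticTheory.HeatConduction.PhaseSpace N), (Literature.MathematicalPhysics.KineticTheory.HeatConduction.pinnedChain ω₂ lam β γ).IsSteadyState N T_L T_R μ → (Literature.MathematicalPhysics.KineticTheory.HeatConduction.pinnedChain ω₂ lam β γ).IsSteadyState N T_L T_R ν → μ = ν) → ∀ T : ℝ, 0 < T → (∃ μT : MeasureTheory.Measure Literature.MathematicalPhysics.KineticTheory.HeatConduction.ChainConfig, (Literature.MathematicalPhysics.KineticTheory.HeatConduction.pinnedChain ω₂ lam β γ).IsChainGibbsMeasure T μT ∧ ∃ D : Literature.MathematicalPhysics.KineticTheory.HeatConduction.InfiniteChainDynamics (Literature.MathematicalPhysics.KineticTheory.HeatConduction.pinnedChain ω₂ lam β γ), D.PreservesMeasure μT ∧ D.HasGreenKubo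 μT T) → ∃ (μT : MeasureTheory.Measure Literature.MathematicalPhysics.KineticTheory.HeatConduction.ChainConfig) (D : Literature.MathematicalPhysics.KineticTheory.HeatConduction.InfiniteChainDynamics (Literature.MathematicalPhysics.KineticTheory.HeatConduction.pinnedChain ω₂ lam β γ)), (Literature.MathematicalPhysics.KineticTheory.HeatConduction.pinnedChain ω₂ lam β γ).IsChainGibbsMeasure T μT ∧ D.PreservesMeasure μT ∧ D.HasGreenKubo μT T ∧ ∀ μ : (N : ℕ) → ℝ → ℝ → MeasureTheory.Measure (Literature.MathematicalPhysics.KineticTheory.HeatConduction.PhaseSpace N), (∀ (N : ℕ) (T_L T_R : ℝ), 0 < T_L → 0 < T_R → (Literature.MathematicalPhysics.KineticTheory.HeatConduction.pinnedChain ω₂ lam β γ).IsSteadyState N T_L T_R (μ N T_L T_R)) → ∀ Dn : ℕ → ℝ, (∀ N : ℕ, Filter.Tendsto (fun δ : ℝ => (Literature.MathematicalPhysics.KineticTheory.HeatConduction.pinnedChain ω₂ lam β γ).totalCurrent (μ N (T + δ / 2) (T - δ / 2)) / δ) (nhdsWithin 0 {(0 : ℝ)}ᶜ) (nhds (Dn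 N))) → Filter.Tendsto Dn Filter.atTop (nhds (D.greenKuboConductivity μT T))

/-- item stmt-AtomisticToContinuum-3433 · support · rank 9 · open · by planner
[support] REGIME BOUNDARY — NOT ATTACKED BY THIS ROUTE. For pinnedChain ω₂ lam β γ (all > 0) and any
T₀ > 0: if for every T ∈ (0, T₀) some Gibbs state and Gibbs-preserving dynamics satisfy
HasGreenKubo, then the same holds at EVERY T > 0 ('upward continuation in temperature'; by the
conjugacy κ_{lam,β}(T) = κ_{lamT,βT}(1): outward continuation in the couplings along each ray from
the kinetic corner). Trivially implied by stmt-AtomisticToContinuum-0703 (FourierGreenKubo, all T)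
and strictly weaker as a proof obligation (the corner is available as input); no mechanism of THIS
route bears on it — it is the large-anharmonicity half of the conjunct, filed so that the Assembly
is honest about scope. Natural shared target for continuation lines (card
complete-analyticity-vitali-propagation: N-uniform holomorphy/propagation in the coupling) or any
non-perturbative Green–Kubo proof. Sources: BonettoLebowitzReyBellet2000 §7; DeRoeckHuveneers2015
(opposite corner). -/
@[route_item "route-AtomisticToContinuum-KineticCorner"]
def KineticCornerComplement : Prop :=
  ∀ ω₂ lam β γ : ℝ, 0 < ω₂ → 0 < lam → 0 < β → 0 < γ → ∀ T₀ : ℝ, 0 < T₀ → (∀ T : ℝ, 0 < T → T < T₀ → ∃ μ : MeasureTheory.Measure Literature.MathematicalPhysics.KineticTheory.HeatConduction.ChainConfig, (Literature.MathematicalPhysics.KineticTheory.HeatConduction.pinnedChain ω₂ lam β γ).IsChainGibbsMeasure T μ ∧ ∃ D : Literature.MathematicalPhysics.KineticTheory.HeatConduction.InfiniteChainDynamics (Literature.MathematicalPhysics.KineticTheory.HeatConduction.pinnedChain ω₂ lam β γ), D.PreservesMeasure μ ∧ D.HasGreenKubo μ T) → ∀ T : ℝ, 0 < T → ∃ μ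 : MeasureTheory.Measure Literature.MathematicalPhysics.KineticTheory.HeatConduction.ChainConfig, (Literature.MathematicalPhysics.KineticTheory.HeatConduction.pinnedChain ω₂ lam β γ).IsChainGibbsMeasure T μ ∧ ∃ D : Literature.MathematicalPhysics.KineticTheory.HeatConduction.InfiniteChainDynamics (Literature.MathematicalPhysics.KineticTheory.HeatConduction.pinnedChain ω₂ lam β γ), D.PreservesMeasure μ ∧ D.HasGreenKubo μ T

/-- item stmt-AtomisticToContinuum-3434 · support · rank 9 · closed · proved by Summit.AtomisticToContinuum.FouriersLaw.Theorems.KineticCorner.goodFamilyExists_proof @ 8c991e5470ec (prover) · by planner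
[support] GOOD TRIPLES EXIST (InfiniteVolumeSetup stmt-AtomisticToContinuum-0743 strengthened by
what the kinetic cruxes quantify over). For pinnedChain ω₂ lam β γ (all > 0) and every T > 0 there
are μ, D forming a GOOD triple (T, μ, D): μ a DLR Gibbs state of pinnedChain ω₂ lam β γ at T
(IsChainGibbsMeasure), D an InfiniteChainDynamics preserving μ, absolutely convergent current
correlations at every t (HasAbsConvergentCorrelation), t ↦ C_T(t) := D.currentCorrelation μ t
locally integrable on [0,S], μ invariant under the lattice shift σ ↦ σ(·+1), and the flow
shift-covariant. Content beyond 0743 (∃ DLR state + μ-preserving dynamics): translation invariance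
of μ (the tempered DLR state of the superstable nearest-neighbour chain built from the transfer
operator e^{−U/2T}e^{−V(q′−q)/T}e^{−U/2T} is shift-invariant), shift-covariance of the flow
(construct D as the μ-a.e. limit of severed flows on [−n, n], LanfordLebowitzLieb1977 Thm 3, with a
shift-invariant tempered carrier and uniqueness of tempered solutions, LLL Thm 4 /
Dobrushin–Fritz-type estimates; BCDM doi:10.1007/s10955-007-9278-0 for quartic pinning + harmonic
coupling), absolute summability Σ_x |E[j_0 · j_x∘φ_t]| < ∞ at eac -/
@[route_item "route-AtomisticToContinuum-KineticCorner"]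
def GoodFamilyExists : Prop :=
  ∀ ω₂ lam β γ : ℝ, 0 < ω₂ → 0 < lam → 0 < β → 0 < γ → ∀ T : ℝ, 0 < T → ∃ (μ : MeasureTheory.Measure Literature.MathematicalPhysics.KineticTheory.HeatConduction.ChainConfig) (D : Literature.MathematicalPhysics.KineticTheory.HeatConduction.InfiniteChainDynamics (Literature.MathematicalPhysics.KineticTheory.HeatConduction.pinnedChain ω₂ lam β γ)), (Literature.MathematicalPhysics.KineticTheory.HeatConduction.pinnedChain ω₂ lam β γ).IsChainGibbsMeasure T μ ∧ D.PreservesMeasure μ ∧ (∀ t : ℝ, D.HasAbsConvergentCorrelation μ t) ∧ (∀ S : ℝ, MeasureTheory.IntegrableOn (D.currentCorrelation μ) (Set.Icc 0 S)) ∧ MeasureTheory.MeasurePreserving (fun σ : Literature.MathematicalPhysics.KineticTheory.HeatConduction.ChainConfig => fun i : ℤ => σ (i + 1)) μ μ ∧ (∀ (t : ℝ) (σ : Literature.MathematicalPhysics.KineticTheory.HeatConduction.ChainConfig), D.flow t (fun i : ℤ => σ (i + 1)) = fun i : ℤ => D.flow t σ (i + 1))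

/-- item stmt-AtomisticToContinuum-3435 · support · rank 9 · closed · proved by Summit.AtomisticToContinuum.FouriersLaw.Theorems.KineticCorner.stationaryCorrelationBound_proof @ 25b9b46dbbca (prover) · by planner
[support] A PRIORI BOUND |C_T(t)| ≤ B·T² (the initial-layer input of TargetGlue). For pinnedChain ω₂
lam β γ (all > 0) there are B and T₁ > 0 such that every GOOD triple (T, μ, D): μ a DLR Gibbs state
of pinnedChain ω₂ lam β γ at T (IsChainGibbsMeasure), D an InfiniteChainDynamics preserving μ,
absolutely convergent current correlations at every t (HasAbsConvergentCorrelation), t ↦ C_T(t) :=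
D.currentCorrelation μ t locally integrable on [0,S], μ invariant under the lattice shift σ ↦
σ(·+1), and the flow shift-covariant. with 0 < T < T₁ satisfies |C_T(t)| ≤ B·T² for all t ≥ 0. Proof
sketch (routine): stationarity of μ under φ_t + Cauchy–Schwarz + translation invariance/covariance +
absolute summability give |C_T(t)| ≤ C_T(0) (C_T(t) = lim_Λ |Λ|⁻¹E[J_Λ(0)J_Λ(t)], J_Λ = Σ_{x∈Λ} j_x,
boundary terms o(|Λ|) by summability); at t = 0 the momenta are i.i.d. N(0,T) independent of
positions, so E[j_0 j_x] = ¼E[(p_0+p_1)(p_x+p_{x+1})]E[V′(r_0)V′(r_x)] vanishes for |x| ≥ 2 and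
C_T(0) = Σ_{|x|≤1}E[j_0 j_x] ≤ T·E[V′(r)²] with V′(r) = r + βr³, r = q_1 − q_0; E[r²] ≤ c·T and
E[r⁶] ≤ c·T³ for the uniformly log-concave Gibbs state (U″ ≥ ω₂, V″ ≥ 1: Brascamp–Lieb variance
bound and log-concave momen -/
@[route_item "route-AtomisticToContinuum-KineticCorner", crux]
def StationaryCorrelationBound : Prop :=
  ∀ ω₂ lam β γ : ℝ, 0 < ω₂ → 0 < lam → 0 < β → 0 < γ → ∃ B T₁ : ℝ, 0 < T₁ ∧ ∀ (T : ℝ) (μ : MeasureTheory.Measure Literature.MathematicalPhysics.KineticTheory.HeatConduction.ChainConfig) (D : Literature.MathematicalPhysics.KineticTheory.HeatConduction.InfiniteChainDynamics (Literature.MathematicalPhysics.KineticTheory.HeatConduction.pinnedChain ω₂ lam β γ)), 0 < T → T < T₁ → ((Literature.MathematicalPhysics.KineticTheory.HeatConduction.pinnedChain ω₂ lam β γ).IsChainGibbsMeasure T μ ∧ D.PreservesMeasure μ ∧ (∀ t : ℝ, D.HasAbsConvergentCorrelation μ t) ∧ (∀ S : ℝ, MeasureTheory.IntegrableOn (D.currentCorrelation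 μ) (Set.Icc 0 S)) ∧ MeasureTheory.MeasurePreserving (fun σ : Literature.MathematicalPhysics.KineticTheory.HeatConduction.ChainConfig => fun i : ℤ => σ (i + 1)) μ μ ∧ (∀ (t : ℝ) (σ : Literature.MathematicalPhysics.KineticTheory.HeatConduction.ChainConfig), D.flow t (fun i : ℤ => σ (i + 1)) = fun i : ℤ => D.flow t σ (i + 1))) → ∀ t : ℝ, 0 ≤ t → |D.currentCorrelation μ t| ≤ B * T ^ 2

/-- item stmt-AtomisticToContinuum-3436 · support · rank 10 · closed · proved by Summit.AtomisticToContinuum.FouriersLaw.Theorems.DrudeDissolution.LineSketch.stub_targetGlue (prover) · by planner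
[support] GLUE OF THE REGIME DELIVERABLE (provable NOW; pure real analysis, ~150 lines):
PostKineticTail → KineticLimit → StationaryCorrelationBound → GoodFamilyExists →
KineticCornerGreenKubo. Proof: fix parameters; take K, c := ∫₀^∞ K > 0 from KineticLimit. Given e >
0 (replace e by min(e, c/2)): choose δ > 0 with B·δ ≤ e/4 and |∫_{(0,δ]} K| ≤ e/8 (K ∈ L¹); take
(M₀, T₀′) from PostKineticTail with e/4 and M ≥ max(M₀, δ) with |∫_{(M,∞)} K| ≤ e/8 (tail of an L¹
function; the tail bound is monotone in M: (M T⁻², ∞) ⊆ (M₀T⁻², ∞)); take T₀″ from KineticLimit with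
(δ, M, e/4) and T₁ := min(T₀′, T₀″, T₁(bound)). For a good triple with T < T₁: C_T is integrable on
[0, MT⁻²] (local integrability) and on (MT⁻², ∞) (tail) hence on (0, ∞); split ∫₀^∞ C_T over (0,
δT⁻²] (|·| ≤ B T²·δT⁻² = Bδ ≤ e/4), (δT⁻², MT⁻²] (= the interval integral, within e/4 of ∫_δ^M K,
itself within e/4 of c) and (MT⁻², ∞) (≤ e/4): |∫₀^∞ C_T − c| ≤ e, so ∫₀^∞ C_T ≥ c/2 > 0;
T²·greenKuboConductivity = T²·(T²)⁻¹∫_{Ioi 0} C_T = ∫₀^∞ C_T (T ≠ 0); HasGreenKubo = (abs.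
convergence ∀t, from GOOD) ∧ IntegrableOn ∧ positivity. Clause (i) of the Target with T₀ := T₁(c/2)
and the triple supplied by GoodFamilyExists. Mathlib: int -/
@[route_item "route-AtomisticToContinuum-KineticCorner"]
def TargetGlue : Prop :=
  PostKineticTail → KineticLimit → StationaryCorrelationBound → GoodFamilyExists → KineticCornerGreenKubo

/-- item stmt-AtomisticToContinuum-3437 · assembly · rank 1 · closed · proved by Summit.AtomisticToContinuum.FouriersLaw.Theorems.KineticCorner.assembly_proof @ 1fef42270ca7 (prover) · by planner
[assembly] KineticCornerGreenKubo → KineticCornerComplement → NessUnique → FiniteResponseOfUnique →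
ThermodynamicLimit → FouriersLaw. Glue VERIFIED rc0 in the planner sketch (SketchCheck.lean, 25
lines): for parameters > 0, Target clause (i) + Complement give the 0703-conclusion ∃(μ_T, D) with
HasGreenKubo at EVERY T > 0; clause (i) of FouriersLawFor from
Literature.MathematicalPhysics.KineticTheory.HeatConduction.pinnedChain_exists_isSteadyState
(LangevinChainNESSHolds.lean; the fact CuneoEckmannHairerReyBellet2018_pinnedChain is PROVED) +
NessUnique (apply with (ν, μ) to get ν = μ); κ T := greenKuboConductivity of the Classical.choose
witnesses of ThermodynamicLimit … T hT (GK at T) for T > 0 (else 1), positivity by HasGreenKubo.pos;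
for a steady-state family μ, Dn N := Classical.choose (FiniteResponseOfUnique … N) (choose Dn hDn),
then the ThermodynamicLimit spec. Provers: import
Literature.MathematicalPhysics.KineticTheory.InfiniteChainDynamics and
Literature.MathematicalPhysics.KineticTheory.LangevinChainNESSHolds. Same frame as
FourierGreenKubo's Assembly3 (stmt-0744) with its GreenKubo hypothesis replaced by Target +
Complement. -/
@[route_item "route-AtomisticToContinuum-KineticCorner"]
def Assembly : Prop :=
  KineticCornerGreenKubo → KineticCornerComplement → NessUnique → FiniteResponseOfUnique → ThermodynamicLimit → FouriersLaw

end Summit.AtomisticToContinuum.FouriersLaw.Theses.KineticCorner
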